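import Mathlib
import Summits.ValiantsHypothesis.ValiantsHypothesis.Theorems.LiouvilleSarnakAlignedCutRank
import Summits.ValiantsHypothesis.ValiantsHypothesis.Theorems.LiouvilleSarnakLiouvilleCutRankOrbitRigidity
import Literature.Computability.AlgebraicComplexity.BooleanGadgets
import Summits.ValiantsHypothesis.ValiantsHypothesis.Theorems.LiouvilleSarnakLiouvilleCutRankBlockEntropy

/-!
# Route LiouvilleSarnak — crux `LiouvilleCutRank` (stmt-ValiantsHypothesis-14775):
# the INFINITE-WORD MATRIX — shift embedding, orbit rigidity, unbalanced window embedding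

For an infinite cut word `t : ℕ → Bool` (`t i = true` iff bit position `i` is a ROW position) the infinite
Liouville cut matrix is indexed by finite sets `X, Y ⊆ ℕ` (the positions of the `1`-bits of a row / column
index; bits of `X` at column positions and bits of `Y` at row positions are ignored):
`A_t(X, Y) = λ(N_t(X, Y) + 1)`, `N_t(X, Y) = Σ_{i ∈ X, t i} 2^i + Σ_{i ∈ Y, ¬ t i} 2^i`
(written out inline everywhere — no definitions).

* §1 `shift_cutNumber_succ`, `liouville_shift` — freezing the `u` lowest positions to `1` and shifting:
  `N_t(range u ∪ (u + X), range u ∪ (u + Y)) + 1 = 2^u (N_{σ^u t}(X, Y) + 1)`, hence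
  `A_t(range u ∪ (u+X), range u ∪ (u+Y)) = (-1)^u A_{σ^u t}(X, Y)` (`λ(2^u m) = (-1)^u λ(m)`).
* §2 ★ `orbitRigidity_infiniteWord` — instantiating `…OrbitRigidity.exists_forall_rows_embedded`: if `A_t`
  has finitely many distinct rows then there is `s₀` such that for all `s ≥ s₀` and all `u`, EVERY row of
  `A_{σ^s t}` is the row of an index `range u ∪ (u + X)` (all `u` lowest positions set), and two rows of
  `A_{σ^s t}` agreeing at all columns `range u ∪ (u + Y)` are equal.
* §3 ★ `card_truncRows_le_two_pow_rank` — UNBALANCED WINDOW EMBEDDING: if the row/column word of a balanced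
  cut `π` (any level) agrees with `t` on the window `s, …, s+m-1`, then the number of distinct rows of the
  level-`m` truncation of `A_t` (`X, Y ⊆ range m`) is at most `2^{rank M_π}`: the assignment "bits below the
  window `1`, window bits from `X` / `Y`, bits above `0`" realises `(-1)^s A_t(X, Y)` as entries of `M_π`.
* The sequel `Theorems/LiouvilleSarnakLiouvilleCutRankInfiniteWordsReduction.lean` turns infinitely many
  rows of `A_t` into a forcing prefix of `t` and, with `…Compactness`, reduces the crux to "long run anywhere"
  + "infinitely many rows for every bounded-run infinite word".

Honest framing: reductions and tools; `LiouvilleCutRank`, `DigitalBilinearLiouville`, `AlgebraicSarnak` stay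
OPEN; nothing here bears on `VP ≠ VNP`.  No definitions.
-/

set_option linter.dupNamespace false

namespace Summit.ValiantsHypothesis.ValiantsHypothesis.Theorems.LiouvilleSarnakLiouvilleCutRank.InfiniteWords

open ArithmeticFunction Finset

open Summit.ValiantsHypothesis.ValiantsHypothesis.Theorems.LiouvilleSarnakAligned
  (card_image_row_le_two_pow_rank liouville_two_pow_mul)
open Summit.ValiantsHypothesis.ValiantsHypothesis.Theorems.LiouvilleSarnakLiouvilleCutRank.OrbitRigidity
  (exists_forall_rows_embedded)
open Literature.Computability.AlgebraicComplexity.BoolGadgets (ofBits_eq_sum)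
open Summit.ValiantsHypothesis.ValiantsHypothesis.Theorems.LiouvilleSarnakLiouvilleCutRank.BlockEntropy
  (liouville_succ_eq_or)

/-! ### §1 The shift embedding of the infinite-word matrix -/

/-- `Σ_{j<u} 2^j + 1 = 2^u`. [folklore] -/
theorem sum_range_two_pow_add_one (u : ℕ) : (∑ j ∈ range u, 2 ^ j) + 1 = 2 ^ u := by
  induction u with
  | zero => simp
  | succ u ih => rw [Finset.sum_range_succ, Nat.add_right_comm, ih]; ring

/-- The `u` lowest positions, read once as row bits and once as column bits of the word `t`, contribute
`2^u - 1`: `Σ_{i<u, t i} 2^i + Σ_{i<u, ¬t i} 2^i + 1 = 2^u`. [folklore] -/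
theorem sum_range_rowcol_add_one (t : ℕ → Bool) (u : ℕ) :
    (∑ i ∈ range u, (if t i then 2 ^ i else 0)) + (∑ i ∈ range u, (if t i then 0 else 2 ^ i)) + 1 =
      2 ^ u := by
  rw [← Finset.sum_add_distrib]
  have h : ∀ i ∈ range u, ((if t i then 2 ^ i else 0) + (if t i then 0 else 2 ^ i)) = 2 ^ i := by
    intro i _; cases t i <;> simp
  rw [Finset.sum_congr rfl h]
  exact sum_range_two_pow_add_one u

/-- **Shift identity for the cut number.**  Freezing the `u` lowest positions to `1` and placing `X`, `Y`
above them: `N_t(range u ∪ (u + X), range u ∪ (u + Y)) + 1 = 2^u · (N_{σ^u t}(X, Y) + 1)`. [folklore] -/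
theorem shift_cutNumber (t : ℕ → Bool) (u : ℕ) (X Y : Finset ℕ) :
    (∑ i ∈ range u ∪ X.image (fun i => u + i), (if t i then 2 ^ i else 0)) +
      (∑ i ∈ range u ∪ Y.image (fun i => u + i), (if t i then 0 else 2 ^ i)) + 1 =
      2 ^ u * ((∑ i ∈ X, (if t (u + i) then 2 ^ i else 0)) +
        (∑ i ∈ Y, (if t (u + i) then 0 else 2 ^ i)) + 1) := by
  have hdisj : ∀ Z : Finset ℕ, Disjoint (range u) (Z.image (fun i => u + i)) := by
    intro Z
    rw [Finset.disjoint_left]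
    intro i hi hi'
    rw [Finset.mem_range] at hi
    obtain ⟨j, _, rfl⟩ := Finset.mem_image.mp hi'
    omega
  have hinj : ∀ Z : Finset ℕ, Set.InjOn (fun i => u + i) ↑Z := fun Z a _ b _ h => by
    simpa using h
  rw [Finset.sum_union (hdisj X), Finset.sum_union (hdisj Y), Finset.sum_image (hinj X),
    Finset.sum_image (hinj Y)]
  have hX : ∑ i ∈ X, (if t (u + i) then 2 ^ (u + i) else 0) =
      2 ^ u * ∑ i ∈ X, (if t (u + i) then 2 ^ i else 0) := by
    rw [Finset.mul_sum]
    refine Finset.sum_congr rfl fun i _ => ?_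
    cases t (u + i) <;> simp [pow_add]
  have hY : ∑ i ∈ Y, (if t (u + i) then 0 else 2 ^ (u + i)) =
      2 ^ u * ∑ i ∈ Y, (if t (u + i) then 0 else 2 ^ i) := by
    rw [Finset.mul_sum]
    refine Finset.sum_congr rfl fun i _ => ?_
    cases t (u + i) <;> simp [pow_add]
  rw [hX, hY]
  have h1 := sum_range_rowcol_add_one t u
  -- abbreviate
  set a := ∑ i ∈ range u, (if t i then 2 ^ i else 0)
  set b := ∑ i ∈ range u, (if t i then 0 else 2 ^ i)
  set p := ∑ i ∈ X, (if t (u + i) then 2 ^ i else 0)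
  set q := ∑ i ∈ Y, (if t (u + i) then 0 else 2 ^ i)
  calc a + 2 ^ u * p + (b + 2 ^ u * q) + 1 = (a + b + 1) + 2 ^ u * p + 2 ^ u * q := by ring
    _ = 2 ^ u + 2 ^ u * p + 2 ^ u * q := by rw [h1]
    _ = 2 ^ u * (p + q + 1) := by ring

/-- **Shift embedding of the infinite-word matrix.**
`A_t(range u ∪ (u+X), range u ∪ (u+Y)) = (-1)^u · A_{σ^u t}(X, Y)`. [folklore] -/
theorem liouville_shift (t : ℕ → Bool) (u : ℕ) (X Y : Finset ℕ) :
    liouville ((∑ i ∈ range u ∪ X.image (fun i => u + i), (if t i then 2 ^ i else 0)) +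
      (∑ i ∈ range u ∪ Y.image (fun i => u + i), (if t i then 0 else 2 ^ i)) + 1) =
      (-1) ^ u * liouville ((∑ i ∈ X, (if t (u + i) then 2 ^ i else 0)) +
        (∑ i ∈ Y, (if t (u + i) then 0 else 2 ^ i)) + 1) := by
  rw [shift_cutNumber, liouville_two_pow_mul]

/-! ### §2 Orbit rigidity of the infinite-word matrix -/

/-- ★ **Orbit rigidity for an infinite cut word.**  If the infinite Liouville cut matrix
`A_t(X, Y) = λ(N_t(X,Y) + 1)` of `t` has finitely many distinct rows, then there is `s₀` such that for every
shift `s ≥ s₀` and every depth `u`: every row of `A_{σ^s t}` is the row of an index with all `u` lowest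
positions set (`range u ∪ (u + X)`), and two rows of `A_{σ^s t}` that agree at every column with all `u`
lowest positions set are equal.  (`…OrbitRigidity.exists_forall_rows_embedded` with §1.) [this file] -/
theorem orbitRigidity_infiniteWord (t : ℕ → Bool)
    (hfin : (Set.range fun X Y : Finset ℕ =>
      liouville ((∑ i ∈ X, (if t i then 2 ^ i else 0)) +
        (∑ i ∈ Y, (if t i then 0 else 2 ^ i)) + 1)).Finite) :
    ∃ s₀ : ℕ, ∀ s, s₀ ≤ s → ∀ u : ℕ,
      (∀ Z : Finset ℕ, ∃ X : Finset ℕ,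
        (fun Y : Finset ℕ => liouville ((∑ i ∈ Z, (if t (s + i) then 2 ^ i else 0)) +
            (∑ i ∈ Y, (if t (s + i) then 0 else 2 ^ i)) + 1)) =
        (fun Y : Finset ℕ => liouville
            ((∑ i ∈ range u ∪ X.image (fun i => u + i), (if t (s + i) then 2 ^ i else 0)) +
            (∑ i ∈ Y, (if t (s + i) then 0 else 2 ^ i)) + 1))) ∧
      (∀ X X' : Finset ℕ,
        (∀ Y : Finset ℕ,
          liouville ((∑ i ∈ X, (if t (s + i) then 2 ^ i else 0)) +
            (∑ i ∈ range u ∪ Y.image (fun i => u + i), (if t (s + i) then 0 else 2 ^ i)) + 1) =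
          liouville ((∑ i ∈ X', (if t (s + i) then 2 ^ i else 0)) +
            (∑ i ∈ range u ∪ Y.image (fun i => u + i), (if t (s + i) then 0 else 2 ^ i)) + 1)) →
        (fun Y : Finset ℕ => liouville ((∑ i ∈ X, (if t (s + i) then 2 ^ i else 0)) +
            (∑ i ∈ Y, (if t (s + i) then 0 else 2 ^ i)) + 1)) =
        (fun Y : Finset ℕ => liouville ((∑ i ∈ X', (if t (s + i) then 2 ^ i else 0)) +
            (∑ i ∈ Y, (if t (s + i) then 0 else 2 ^ i)) + 1))) := by
  -- the orbit of matrices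
  set A : ℕ → Finset ℕ → Finset ℕ → ℤ := fun s X Y =>
    liouville ((∑ i ∈ X, (if t (s + i) then 2 ^ i else 0)) +
      (∑ i ∈ Y, (if t (s + i) then 0 else 2 ^ i)) + 1) with hA
  have hΦ : ∀ s u (X Y : Finset ℕ),
      A s (range u ∪ X.image (fun i => u + i)) (range u ∪ Y.image (fun i => u + i)) =
        (-1) ^ u * A (s + u) X Y := by
    intro s u X Y
    simp only [hA]
    rw [liouville_shift (fun i => t (s + i)) u X Y]
    simp only [Nat.add_assoc]
  have hsq : ∀ u : ℕ, ((-1 : ℤ) ^ u) * ((-1 : ℤ) ^ u) = 1 := by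
    intro u; rw [← mul_pow]; norm_num
  have hfin0 : (Set.range (A 0)).Finite := by
    have : A 0 = fun X Y : Finset ℕ => liouville ((∑ i ∈ X, (if t i then 2 ^ i else 0)) +
        (∑ i ∈ Y, (if t i then 0 else 2 ^ i)) + 1) := by
      funext X Y; simp only [hA, Nat.zero_add]
    rw [this]; exact hfin
  obtain ⟨s₀, hs₀⟩ := exists_forall_rows_embedded A
    (fun _ X => range 1 ∪ X.image (fun i => 1 + i)) (fun _ Y => range 1 ∪ Y.image (fun i => 1 + i))
    (fun _ => (-1) ^ 1) (fun _ => hsq 1) (fun s X Y => hΦ s 1 X Y)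
    (fun _ u X => range u ∪ X.image (fun i => u + i)) (fun _ u Y => range u ∪ Y.image (fun i => u + i))
    (fun _ u => (-1) ^ u) (fun _ u => hsq u) (fun s u X Y => hΦ s u X Y) hfin0
  refine ⟨s₀, fun s hs u => ?_⟩
  obtain ⟨h1, h2⟩ := hs₀ s hs u
  exact ⟨fun Z => h1 Z, fun X X' h => h2 X X' h⟩


/-! ### §3 The unbalanced window embedding -/

/-- **Digit bookkeeping for a window.**  Let the row/column word `w` of the cut `π` agree with `t` on the
window `s, …, s + m - 1` (`s + m ≤ 2n`).  For finite sets `X, Y ⊆ ℕ` let the row index `ρ_X` have bit `1`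
at the row positions below the window and at the row positions `s + i`, `i ∈ X`, `i < m` (and `0`
elsewhere), and similarly the column index `γ_Y`.  Then `N_π(ρ_X, γ_Y) + 1 = 2^s (N_t(X ∩ [0,m), Y ∩ [0,m)) + 1)`.
[folklore] -/
theorem ofBits_window_add_one (t : ℕ → Bool) (m n : ℕ) (π : Fin n ⊕ Fin n ≃ Fin (2 * n))
    (w : ℕ → Bool) (hw : ∀ j : Fin (2 * n), w j = (π.symm j).isLeft) (s : ℕ) (hs : s + m ≤ 2 * n)
    (ht : ∀ k < m, w (s + k) = t k) (X Y : Finset ℕ) :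
    Nat.ofBits (fun j : Fin (2 * n) => Sum.elim
        (fun i : Fin n => decide ((π (Sum.inl i) : ℕ) < s ∨
          ((π (Sum.inl i) : ℕ) < s + m ∧ (π (Sum.inl i) : ℕ) - s ∈ X)))
        (fun i : Fin n => decide ((π (Sum.inr i) : ℕ) < s ∨
          ((π (Sum.inr i) : ℕ) < s + m ∧ (π (Sum.inr i) : ℕ) - s ∈ Y)))
        (π.symm j)) + 1 =
      2 ^ s * ((∑ i ∈ X ∩ range m, (if t i then 2 ^ i else 0)) +
        (∑ i ∈ Y ∩ range m, (if t i then 0 else 2 ^ i)) + 1) := by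
  classical
  -- the bit stream as a function on `ℕ`
  set b : ℕ → ℕ := fun j =>
    if j < s then 1 else if j < s + m then (if (j - s) ∈ (if t (j - s) then X else Y) then 1 else 0)
    else 0 with hb
  have hbit : ∀ j : Fin (2 * n),
      (Sum.elim
        (fun i : Fin n => decide ((π (Sum.inl i) : ℕ) < s ∨
          ((π (Sum.inl i) : ℕ) < s + m ∧ (π (Sum.inl i) : ℕ) - s ∈ X)))
        (fun i : Fin n => decide ((π (Sum.inr i) : ℕ) < s ∨
          ((π (Sum.inr i) : ℕ) < s + m ∧ (π (Sum.inr i) : ℕ) - s ∈ Y)))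
        (π.symm j)).toNat = b j := by
    intro j
    have hwj := hw j
    rcases hq : π.symm j with i | i
    · have hπ : π (Sum.inl i) = j := by rw [← hq, Equiv.apply_symm_apply]
      rw [hq] at hwj
      simp only [Sum.isLeft_inl] at hwj
      simp only [Sum.elim_inl, hπ]
      by_cases h1 : (j : ℕ) < s
      · simp [hb, h1]
      · by_cases h2 : (j : ℕ) < s + m
        · have htj : t ((j : ℕ) - s) = true := by
            rw [← ht ((j : ℕ) - s) (by omega), Nat.add_sub_cancel' (by omega), hwj]
          by_cases h3 : (j : ℕ) - s ∈ X
          · simp [hb, h1, h2, h3, htj]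
          · simp [hb, h1, h2, h3, htj]
        · simp [hb, h1, h2]
    · have hπ : π (Sum.inr i) = j := by rw [← hq, Equiv.apply_symm_apply]
      rw [hq] at hwj
      simp only [Sum.isLeft_inr] at hwj
      simp only [Sum.elim_inr, hπ]
      by_cases h1 : (j : ℕ) < s
      · simp [hb, h1]
      · by_cases h2 : (j : ℕ) < s + m
        · have htj : t ((j : ℕ) - s) = false := by
            rw [← ht ((j : ℕ) - s) (by omega), Nat.add_sub_cancel' (by omega), hwj]
          by_cases h3 : (j : ℕ) - s ∈ Y
          · simp [hb, h1, h2, h3, htj]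
          · simp [hb, h1, h2, h3, htj]
        · simp [hb, h1, h2]
  rw [ofBits_eq_sum]
  simp only [hbit]
  have hsum : (∑ j : Fin (2 * n), b j * 2 ^ (j : ℕ)) = ∑ j ∈ range (2 * n), b j * 2 ^ j :=
    Fin.sum_univ_eq_sum_range (fun j => b j * 2 ^ j) (2 * n)
  rw [hsum]
  -- split the range `[0, 2n)` at `s` and `s + m`
  rw [← Finset.sum_range_add_sum_Ico _ (show s ≤ 2 * n by omega),
    ← Finset.sum_Ico_consecutive _ (show s ≤ s + m by omega) hs]
  have hlow : ∑ j ∈ range s, b j * 2 ^ j = ∑ j ∈ range s, 2 ^ j := by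
    refine Finset.sum_congr rfl fun j hj => ?_
    rw [Finset.mem_range] at hj
    simp [hb, hj]
  have hhigh : ∑ j ∈ Ico (s + m) (2 * n), b j * 2 ^ j = 0 := by
    refine Finset.sum_eq_zero fun j hj => ?_
    rw [Finset.mem_Ico] at hj
    have h1 : ¬ j < s := by omega
    have h2 : ¬ j < s + m := by omega
    simp [hb, h1, h2]
  have hmid : ∑ j ∈ Ico s (s + m), b j * 2 ^ j =
      2 ^ s * ((∑ i ∈ X ∩ range m, (if t i then 2 ^ i else 0)) +
        (∑ i ∈ Y ∩ range m, (if t i then 0 else 2 ^ i))) := by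
    rw [Finset.sum_Ico_eq_sum_range, Nat.add_sub_cancel_left]
    have hX : ∑ i ∈ X ∩ range m, (if t i then 2 ^ i else 0) =
        ∑ i ∈ range m, (if i ∈ X then (if t i then 2 ^ i else 0) else 0) := by
      symm
      rw [Finset.sum_ite_mem, Finset.inter_comm]
    have hY : ∑ i ∈ Y ∩ range m, (if t i then 0 else 2 ^ i) =
        ∑ i ∈ range m, (if i ∈ Y then (if t i then 0 else 2 ^ i) else 0) := by
      symm
      rw [Finset.sum_ite_mem, Finset.inter_comm]
    rw [hX, hY, ← Finset.sum_add_distrib, Finset.mul_sum]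
    refine Finset.sum_congr rfl fun k hk => ?_
    rw [Finset.mem_range] at hk
    have h1 : ¬ s + k < s := by omega
    have h2 : s + k < s + m := by omega
    simp only [hb, h1, if_false, h2, if_true, Nat.add_sub_cancel_left, pow_add]
    by_cases hX' : k ∈ X <;> by_cases hY' : k ∈ Y <;> cases t k <;> simp [hX', hY']
  rw [hlow, hmid, hhigh, add_zero]
  have hgeom : ∑ j ∈ range s, 2 ^ j + 1 = 2 ^ s := sum_range_two_pow_add_one s
  calc ∑ j ∈ range s, 2 ^ j + 2 ^ s * ((∑ i ∈ X ∩ range m, (if t i then 2 ^ i else 0)) +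
          (∑ i ∈ Y ∩ range m, (if t i then 0 else 2 ^ i))) + 1
        = (∑ j ∈ range s, 2 ^ j + 1) + 2 ^ s * ((∑ i ∈ X ∩ range m, (if t i then 2 ^ i else 0)) +
          (∑ i ∈ Y ∩ range m, (if t i then 0 else 2 ^ i))) := by ring
    _ = 2 ^ s * ((∑ i ∈ X ∩ range m, (if t i then 2 ^ i else 0)) +
        (∑ i ∈ Y ∩ range m, (if t i then 0 else 2 ^ i)) + 1) := by rw [hgeom]; ring

open scoped Classical in
/-- ★ **Unbalanced window embedding (distinct-rows form).**  If the row/column word `w` of a balanced cut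
`π` (any level `n`) agrees with the infinite word `t` on the window `s, …, s + m - 1`, then the level-`m`
truncation of the infinite matrix `A_t` (rows `X ⊆ [0, m)`, columns read modulo `[0, m)`) has at most
`2^{rank M_π}` distinct rows: `(-1)^s A_t(X, Y)` is the entry of `M_π` at (bits below the window `1`,
window bits from `X` / `Y`, bits above `0`), and a `±1` matrix of rank `r` has `≤ 2^r` distinct rows.
[this file] -/
theorem card_truncRows_le_two_pow_rank (t : ℕ → Bool) (m n : ℕ) (π : Fin n ⊕ Fin n ≃ Fin (2 * n))
    (w : ℕ → Bool) (hw : ∀ j : Fin (2 * n), w j = (π.symm j).isLeft) (s : ℕ) (hs : s + m ≤ 2 * n)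
    (ht : ∀ k < m, w (s + k) = t k) :
    ((range m).powerset.image fun X : Finset ℕ => fun Y : Finset ℕ =>
        liouville ((∑ i ∈ X, (if t i then 2 ^ i else 0)) +
          (∑ i ∈ Y ∩ range m, (if t i then 0 else 2 ^ i)) + 1)).card ≤
      2 ^ (Matrix.of fun r c : Fin n → Bool =>
        (((liouville (Nat.ofBits (fun j : Fin (2 * n) => Sum.elim r c (π.symm j)) + 1) : ℤ) :
          ℂ))).rank := by
  classical
  set M : Matrix (Fin n → Bool) (Fin n → Bool) ℂ := Matrix.of fun r c : Fin n → Bool =>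
      (((liouville (Nat.ofBits (fun j : Fin (2 * n) => Sum.elim r c (π.symm j)) + 1) : ℤ) : ℂ))
    with hM
  -- row / column indices attached to finite sets
  set ρ : Finset ℕ → (Fin n → Bool) := fun X i =>
    decide ((π (Sum.inl i) : ℕ) < s ∨ ((π (Sum.inl i) : ℕ) < s + m ∧ (π (Sum.inl i) : ℕ) - s ∈ X))
    with hρ
  set γ : Finset ℕ → (Fin n → Bool) := fun Y i =>
    decide ((π (Sum.inr i) : ℕ) < s ∨ ((π (Sum.inr i) : ℕ) < s + m ∧ (π (Sum.inr i) : ℕ) - s ∈ Y))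
    with hγ
  set F : Finset ℕ → Finset ℕ → ℤ := fun X Y =>
    liouville ((∑ i ∈ X, (if t i then 2 ^ i else 0)) +
      (∑ i ∈ Y ∩ range m, (if t i then 0 else 2 ^ i)) + 1) with hF
  -- the entry identity
  have hentry : ∀ X ∈ (range m).powerset, ∀ Y : Finset ℕ,
      M (ρ X) (γ Y) = (((-1) ^ s * F X Y : ℤ) : ℂ) := by
    intro X hX Y
    have hXm : X ∩ range m = X := Finset.inter_eq_left.mpr (Finset.mem_powerset.mp hX)
    have h' : Nat.ofBits (fun j : Fin (2 * n) => Sum.elim (ρ X) (γ Y) (π.symm j)) + 1 =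
        2 ^ s * ((∑ i ∈ X ∩ range m, (if t i then 2 ^ i else 0)) +
          (∑ i ∈ Y ∩ range m, (if t i then 0 else 2 ^ i)) + 1) :=
      ofBits_window_add_one t m n π w hw s hs ht X Y
    rw [hXm] at h'
    simp only [hM, Matrix.of_apply, hF]
    rw [h', liouville_two_pow_mul]
  -- recover the truncated row from the `M`-row
  set g : ((Fin n → Bool) → ℂ) → (Finset ℕ → ℤ) := fun row Y =>
    if row (γ Y) = (((-1 : ℤ) ^ s : ℤ) : ℂ) then 1 else -1 with hg
  have hrec : ∀ X ∈ (range m).powerset, F X = g (M (ρ X)) := by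
    intro X hX
    funext Y
    show F X Y = (if M (ρ X) (γ Y) = (((-1 : ℤ) ^ s : ℤ) : ℂ) then 1 else -1)
    rw [hentry X hX Y]
    rcases liouville_succ_eq_or ((∑ i ∈ X, (if t i then 2 ^ i else 0)) +
        (∑ i ∈ Y ∩ range m, (if t i then 0 else 2 ^ i))) with h1 | h1
    · have hF1 : F X Y = 1 := h1
      rw [hF1, mul_one, if_pos rfl]
    · have hF1 : F X Y = -1 := h1
      rw [hF1]
      have hne : (((-1 : ℤ) ^ s * (-1 : ℤ) : ℤ) : ℂ) ≠ (((-1 : ℤ) ^ s : ℤ) : ℂ) := by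
        intro h
        have h1 : (-1 : ℤ) ^ s * (-1) = (-1) ^ s := by exact_mod_cast h
        have h2 : (-1 : ℤ) ^ s * (-1) = (-1) ^ s * 1 := by rw [h1, mul_one]
        have h3 := mul_left_cancel₀ (pow_ne_zero s (by norm_num : (-1 : ℤ) ≠ 0)) h2
        norm_num at h3
      rw [if_neg hne]
  have himage : (range m).powerset.image F =
      (((range m).powerset.image fun X => M (ρ X))).image g := by
    rw [Finset.image_image]
    exact Finset.image_congr fun X hX => by
      rw [Function.comp_apply]; exact hrec X (Finset.mem_coe.mp hX)
  have hsub : ((range m).powerset.image fun X => M (ρ X)) ⊆ Finset.univ.image fun r => M r := by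
    intro f hf
    obtain ⟨X, _, rfl⟩ := Finset.mem_image.mp hf
    exact Finset.mem_image.mpr ⟨ρ X, Finset.mem_univ _, rfl⟩
  have hpm : ∀ i j, M i j = 1 ∨ M i j = -1 := by
    intro i j
    simp only [hM, Matrix.of_apply]
    rcases liouville_succ_eq_or (Nat.ofBits fun j' : Fin (2 * n) => Sum.elim i j (π.symm j'))
      with h | h
    · left; rw [h]; simp
    · right; rw [h]; simp
  calc ((range m).powerset.image F).card
      = ((((range m).powerset.image fun X => M (ρ X))).image g).card := by rw [himage]
    _ ≤ ((range m).powerset.image fun X => M (ρ X)).card := Finset.card_image_le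
    _ ≤ (Finset.univ.image fun r => M r).card := Finset.card_le_card hsub
    _ ≤ 2 ^ M.rank := card_image_row_le_two_pow_rank M hpm

end Summit.ValiantsHypothesis.ValiantsHypothesis.Theorems.LiouvilleSarnakLiouvilleCutRank.InfiniteWords
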